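import Mathlib
import HarnessLib
import Summits.NavierStokesRegularity.NavierStokesRegularity.Theorems.PoloidalWindowRigidity.Negative.TriSheetProfile
import Summits.NavierStokesRegularity.NavierStokesRegularity.Theorems.PoloidalWindowRigidity.Negative.AnyFrameDrift

/-!
# Crux `PoloidalWindowRigidity` (K2, stmt-NavierStokesRegularity-19708) — negative side:
# the three-sheet profile is axisymmetric in NO rigid frame (clause (11) of the residue stub S2⁗)

Negative-side support (refuter seat ns-regularity-refuter1 gen 2, cell ns-regularity-ideate; D-0081 §C), sequel of
`…Negative.TriSheetProfile`.  The any-frame clause (11) «`y ↦ L⁻¹ v(s)(L y + c)` is axisymmetric for no linear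
isometry `L` and no centre `c`» for the three-sheet profile.  The lattice argument of `…Negative.TriWaveFrame`
(three far-apart maxima) is not available — the maximum set of `|S|²` is the ANTIPODAL PAIR `±q`,
`q = (1/3, −1/3, 0)`, where `|S|² = 10B²` (`B = β(1/3)`; `10B² − |S|² = 2(B²−a²) + 2(B²−b²) + 2(B²−c²) +
(2B² + 2ab) + (2B² + 2ac)`, `a, b, c = β(u), β(w), β(p)`).  Frame rotations preserve `|S|`, small ones fix each of
`±q`, so both lie on the axis `c + L(ℝe₂)`: `L e₂ ∥ q` and `c ∈ ℝq`.  The half-turn of the frame is then the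
reflection `X ↦ −X + (2⟪X,q⟫/|q|²) q` through the line `ℝq`; it carries `P = (1/3, 0, 1/3)` to `−P + q =
(0, −1/3, −1/3)`, and `|S(P)|² − |S(−P+q)|² = 2B² + 2Bβ(2/3) > 0`.  WHAT THIS IS NOT: not a claim about
Navier–Stokes — kinematics of an explicit profile; the crux K2 stays open. [folklore]
-/

noncomputable section

-- the summit and its single sub-problem share the name (CONVENTIONS §1), as in every Theorems file
set_option linter.dupNamespace false

namespace Summit.NavierStokesRegularity.NavierStokesRegularity.Theorems.PoloidalWindowRigidity.Negative

open MeasureTheory Set Function Filter Topology Metric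
open scoped RealInnerProductSpace InnerProductSpace ENNReal NNReal
open Literature.Analysis Literature.Analysis.FluidPDE

/-! ## The maximum set of `|S|²` -/

/-- `|S|² = 2a² + 2b² + 2c² − 2ab − 2ac` with `a = β(u)`, `b = β(w)`, `c = β(p)`. [folklore] -/
theorem norm_sq_sheetField (x : EuclideanSpace ℝ (Fin 3)) :
    ‖sheetField x‖ ^ 2 = 2 * oddBump (x 0 + x 2) ^ 2 + 2 * oddBump (x 1 - x 2) ^ 2 + 2 * oddBump (x 1 + x 2) ^ 2 -
      2 * oddBump (x 0 + x 2) * oddBump (x 1 - x 2) - 2 * oddBump (x 0 + x 2) * oddBump (x 1 + x 2) := by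
  rw [Literature.Algebra.EuclideanLattices.norm_sq_fin_three, sheetField_apply_zero, sheetField_apply_one,
    sheetField_apply_two]
  ring

/-- `|S|² ≤ 10B²`. [folklore] -/
theorem norm_sq_sheetField_le (x : EuclideanSpace ℝ (Fin 3)) : ‖sheetField x‖ ^ 2 ≤ 10 * bumpMax ^ 2 := by
  rw [norm_sq_sheetField]
  obtain ⟨ha1, ha2⟩ := abs_le.1 (abs_oddBump_le_bumpMax (x 0 + x 2))
  obtain ⟨hb1, hb2⟩ := abs_le.1 (abs_oddBump_le_bumpMax (x 1 - x 2))
  obtain ⟨hc1, hc2⟩ := abs_le.1 (abs_oddBump_le_bumpMax (x 1 + x 2))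
  nlinarith [mul_nonneg (sub_nonneg.2 ha2) (neg_le_iff_add_nonneg'.1 ha1),
    mul_nonneg (sub_nonneg.2 hb2) (neg_le_iff_add_nonneg'.1 hb1),
    mul_nonneg (sub_nonneg.2 hc2) (neg_le_iff_add_nonneg'.1 hc1),
    mul_nonneg (sub_nonneg.2 ha2) (sub_nonneg.2 hb2), mul_nonneg (neg_le_iff_add_nonneg'.1 ha1)
      (neg_le_iff_add_nonneg'.1 hb1),
    mul_nonneg (sub_nonneg.2 ha2) (sub_nonneg.2 hc2), mul_nonneg (neg_le_iff_add_nonneg'.1 ha1)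
      (neg_le_iff_add_nonneg'.1 hc1)]

/-- **The maximum set of `|S|²` is the antipodal pair `±(1/3, −1/3, 0)`.** [folklore] -/
theorem sheetField_max_iff (x : EuclideanSpace ℝ (Fin 3)) : ‖sheetField x‖ ^ 2 = 10 * bumpMax ^ 2 ↔
    (x 0 = 1 / 3 ∧ x 1 = -(1 / 3) ∧ x 2 = 0) ∨ (x 0 = -(1 / 3) ∧ x 1 = 1 / 3 ∧ x 2 = 0) := by
  have hB := bumpMax_pos
  constructor
  · intro h
    set a := oddBump (x 0 + x 2) with ha
    set b := oddBump (x 1 - x 2) with hb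
    set c := oddBump (x 1 + x 2) with hc
    obtain ⟨ha1, ha2⟩ := abs_le.1 (abs_oddBump_le_bumpMax (x 0 + x 2))
    obtain ⟨hb1, hb2⟩ := abs_le.1 (abs_oddBump_le_bumpMax (x 1 - x 2))
    obtain ⟨hc1, hc2⟩ := abs_le.1 (abs_oddBump_le_bumpMax (x 1 + x 2))
    have t1 := mul_nonneg (sub_nonneg.2 ha2) (neg_le_iff_add_nonneg'.1 ha1)
    have t2 := mul_nonneg (sub_nonneg.2 hb2) (neg_le_iff_add_nonneg'.1 hb1)
    have t3 := mul_nonneg (sub_nonneg.2 hc2) (neg_le_iff_add_nonneg'.1 hc1)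
    have t4 := mul_nonneg (sub_nonneg.2 ha2) (sub_nonneg.2 hb2)
    have t5 := mul_nonneg (neg_le_iff_add_nonneg'.1 ha1) (neg_le_iff_add_nonneg'.1 hb1)
    have t6 := mul_nonneg (sub_nonneg.2 ha2) (sub_nonneg.2 hc2)
    have t7 := mul_nonneg (neg_le_iff_add_nonneg'.1 ha1) (neg_le_iff_add_nonneg'.1 hc1)
    have hid : 2 * ((bumpMax - a) * (bumpMax + a)) + 2 * ((bumpMax - b) * (bumpMax + b)) +
        2 * ((bumpMax - c) * (bumpMax + c)) + (bumpMax - a) * (bumpMax - b) + (bumpMax + a) * (bumpMax + b) +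
        (bumpMax - a) * (bumpMax - c) + (bumpMax + a) * (bumpMax + c) = 10 * bumpMax ^ 2 - ‖sheetField x‖ ^ 2 := by
      rw [norm_sq_sheetField]
      ring
    rw [h, sub_self] at hid
    have e1 : (bumpMax - a) * (bumpMax + a) = 0 := by linarith
    rcases mul_eq_zero.1 e1 with hA | hA
    · -- `a = B`, hence `b = c = −B`
      have haB : a = bumpMax := by linarith
      have e5 : (bumpMax + a) * (bumpMax + b) = 0 := by linarith
      have e7 : (bumpMax + a) * (bumpMax + c) = 0 := by linarith
      have hbB : b = -bumpMax := by
        rcases mul_eq_zero.1 e5 with h' | h' <;> linarith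
      have hcB : c = -bumpMax := by
        rcases mul_eq_zero.1 e7 with h' | h' <;> linarith
      have hu := (oddBump_eq_bumpMax_iff _).1 haB
      have hw := (oddBump_eq_neg_bumpMax_iff _).1 hbB
      have hp := (oddBump_eq_neg_bumpMax_iff _).1 hcB
      left
      refine ⟨by linarith, by linarith, by linarith⟩
    · -- `a = −B`, hence `b = c = B`
      have haB : a = -bumpMax := by linarith
      have e4 : (bumpMax - a) * (bumpMax - b) = 0 := by linarith
      have e6 : (bumpMax - a) * (bumpMax - c) = 0 := by linarith
      have hbB : b = bumpMax := by
        rcases mul_eq_zero.1 e4 with h' | h' <;> linarith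
      have hcB : c = bumpMax := by
        rcases mul_eq_zero.1 e6 with h' | h' <;> linarith
      have hu := (oddBump_eq_neg_bumpMax_iff _).1 haB
      have hw := (oddBump_eq_bumpMax_iff _).1 hbB
      have hp := (oddBump_eq_bumpMax_iff _).1 hcB
      right
      refine ⟨by linarith, by linarith, by linarith⟩
  · rintro (⟨h0, h1, h2⟩ | ⟨h0, h1, h2⟩)
    · have hu : x 0 + x 2 = 1 / 3 := by rw [h0, h2]; norm_num
      have hw : x 1 - x 2 = -(1 / 3) := by rw [h1, h2]; norm_num
      have hp : x 1 + x 2 = -(1 / 3) := by rw [h1, h2]; norm_num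
      rw [norm_sq_sheetField, hu, hw, hp, oddBump_third, oddBump_neg_third]
      ring
    · have hu : x 0 + x 2 = -(1 / 3) := by rw [h0, h2]; norm_num
      have hw : x 1 - x 2 = 1 / 3 := by rw [h1, h2]; norm_num
      have hp : x 1 + x 2 = 1 / 3 := by rw [h1, h2]; norm_num
      rw [norm_sq_sheetField, hu, hw, hp, oddBump_third, oddBump_neg_third]
      ring

/-- Two maximum points of `|S|²` at distance `< 9/10` coincide (`dist(q, −q) = 2√2/3 > 9/10`). [folklore] -/
theorem eq_of_sheetField_max {x Q : EuclideanSpace ℝ (Fin 3)} (hx : ‖sheetField x‖ ^ 2 = 10 * bumpMax ^ 2)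
    (hQ : ‖sheetField Q‖ ^ 2 = 10 * bumpMax ^ 2) (hd : dist x Q < 9 / 10) : x = Q := by
  have hd2 : dist x Q ^ 2 < (9 / 10) ^ 2 := pow_lt_pow_left₀ hd dist_nonneg two_ne_zero
  rw [dist_eq_norm, Literature.Algebra.EuclideanLattices.norm_sq_fin_three] at hd2
  simp only [PiLp.sub_apply] at hd2
  rcases (sheetField_max_iff x).1 hx with ⟨x0, x1, x2⟩ | ⟨x0, x1, x2⟩ <;>
    rcases (sheetField_max_iff Q).1 hQ with ⟨Q0, Q1, Q2⟩ | ⟨Q0, Q1, Q2⟩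
  · ext i
    fin_cases i
    · exact x0.trans Q0.symm
    · exact x1.trans Q1.symm
    · exact x2.trans Q2.symm
  · rw [x0, x1, x2, Q0, Q1, Q2] at hd2
    norm_num at hd2
  · rw [x0, x1, x2, Q0, Q1, Q2] at hd2
    norm_num at hd2
  · ext i
    fin_cases i
    · exact x0.trans Q0.symm
    · exact x1.trans Q1.symm
    · exact x2.trans Q2.symm

/-- `β(2/3) > 0`. [folklore] -/
theorem oddBump_two_thirds_pos : 0 < oddBump (2 / 3) := by
  unfold oddBump
  positivity

/-! ## The any-frame clause -/

/-- **The three-sheet field is axisymmetric in no rigid frame.** [folklore] -/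
theorem sheetField_not_axisymmetric_anyFrame (L : EuclideanSpace ℝ (Fin 3) ≃ₗᵢ[ℝ] EuclideanSpace ℝ (Fin 3))
    (c : EuclideanSpace ℝ (Fin 3)) : ¬ IsAxisymmetric (fun z => L.symm (sheetField (L z + c))) := by
  intro hax
  set M : ℝ := 10 * bumpMax ^ 2 with hM
  -- ## `|S|` is invariant under the rotations of the frame
  have hnorm : ∀ (θ : ℝ) (z : EuclideanSpace ℝ (Fin 3)), ‖sheetField (L (rotZ θ z) + c)‖ = ‖sheetField (L z + c)‖ := by
    intro θ z
    have h := congrArg (fun w : EuclideanSpace ℝ (Fin 3) => ‖w‖) (hax θ z)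
    simpa only [LinearIsometryEquiv.norm_map, norm_rotZ] using h
  -- ## every maximum point of `|S|²` lies on the axis of the frame
  have haxis : ∀ P : EuclideanSpace ℝ (Fin 3), ‖sheetField P‖ ^ 2 = M →
      (L.symm (P - c)) 0 = 0 ∧ (L.symm (P - c)) 1 = 0 := by
    intro P hP
    set z : EuclideanSpace ℝ (Fin 3) := L.symm (P - c) with hz
    have hzP : L z + c = P := by simp [hz]
    have hcont : Continuous fun θ : ℝ => L (rotZ θ z) + c :=
      (L.continuous.comp (continuous_rotZ_angle z)).add continuous_const
    obtain ⟨δ, hδ, hball⟩ := Metric.continuous_iff.1 hcont 0 (9 / 10) (by norm_num)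
    set θ : ℝ := min (δ / 2) 1 with hθ
    have hθpos : 0 < θ := lt_min (by linarith) one_pos
    have hθδ : θ < δ := lt_of_le_of_lt (min_le_left _ _) (by linarith)
    have hθ1 : θ ≤ 1 := min_le_right _ _
    have hcosθ : Real.cos θ ≠ 1 := by
      intro h1
      have h0 := (Real.cos_eq_one_iff_of_lt_of_lt (by linarith [Real.pi_gt_three])
        (by linarith [Real.pi_gt_three])).1 h1
      exact hθpos.ne' h0
    have hclose : dist (L (rotZ θ z) + c) P < 9 / 10 := by
      have h := hball θ (by rw [Real.dist_eq, sub_zero, abs_of_pos hθpos]; exact hθδ)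
      rwa [rotZ_zero, hzP] at h
    have hmax : ‖sheetField (L (rotZ θ z) + c)‖ ^ 2 = M := by rw [hnorm θ z, hzP, hP]
    have hEq : L (rotZ θ z) + c = P := eq_of_sheetField_max hmax hP hclose
    have hfix : rotZ θ z = z := L.injective (add_right_cancel (hEq.trans hzP.symm))
    exact eq_zero_of_rotZ_eq_self hcosθ hfix
  -- ## the two maxima `±q`
  set q : EuclideanSpace ℝ (Fin 3) := (1 / 3 : ℝ) • EuclideanSpace.single (0 : Fin 3) (1 : ℝ) +
    (-(1 / 3) : ℝ) • EuclideanSpace.single (1 : Fin 3) (1 : ℝ) with hq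
  have q0 : q 0 = 1 / 3 := by simp [hq]
  have q1 : q 1 = -(1 / 3) := by simp [hq]
  have q2 : q 2 = 0 := by simp [hq]
  have hqmax : ‖sheetField q‖ ^ 2 = M := (sheetField_max_iff q).2 (Or.inl ⟨q0, q1, q2⟩)
  have hnqmax : ‖sheetField (-q)‖ ^ 2 = M :=
    (sheetField_max_iff (-q)).2 (Or.inr ⟨by simp [q0], by simp [q1], by simp [q2]⟩)
  obtain ⟨a0, a1⟩ := haxis q hqmax
  obtain ⟨b0, b1⟩ := haxis (-q) hnqmax
  -- ## `L⁻¹ q` and `L⁻¹ c` are vertical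
  have hdq : L.symm (q - c) - L.symm (-q - c) = (2 : ℝ) • L.symm q := by
    rw [← map_sub, ← map_smul]
    congr 1
    rw [two_smul]
    abel
  have hdc : L.symm (q - c) + L.symm (-q - c) = (-2 : ℝ) • L.symm c := by
    rw [← map_add, ← map_smul]
    congr 1
    rw [neg_smul, two_smul]
    abel
  set κ : ℝ := (L.symm q) 2 with hκ
  set γ : ℝ := (L.symm c) 2 with hγ
  have hLq : L.symm q = κ • EuclideanSpace.single (2 : Fin 3) (1 : ℝ) := by
    have e0 := congrArg (fun w : EuclideanSpace ℝ (Fin 3) => w 0) hdq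
    have e1 := congrArg (fun w : EuclideanSpace ℝ (Fin 3) => w 1) hdq
    simp only [PiLp.sub_apply, PiLp.smul_apply, smul_eq_mul, a0, a1, b0, b1, sub_zero] at e0 e1
    ext i
    fin_cases i
    · show (L.symm q) 0 = _
      simp
      linarith
    · show (L.symm q) 1 = _
      simp
      linarith
    · show (L.symm q) 2 = _
      simp [hκ]
  have hLc : L.symm c = γ • EuclideanSpace.single (2 : Fin 3) (1 : ℝ) := by
    have e0 := congrArg (fun w : EuclideanSpace ℝ (Fin 3) => w 0) hdc
    have e1 := congrArg (fun w : EuclideanSpace ℝ (Fin 3) => w 1) hdc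
    simp only [PiLp.add_apply, PiLp.smul_apply, smul_eq_mul, a0, a1, b0, b1, add_zero] at e0 e1
    ext i
    fin_cases i
    · show (L.symm c) 0 = _
      simp
      linarith
    · show (L.symm c) 1 = _
      simp
      linarith
    · show (L.symm c) 2 = _
      simp [hγ]
  -- `κ² = |q|² = 2/9`
  have hκ2 : κ ^ 2 = 2 / 9 := by
    have h1 : ‖L.symm q‖ ^ 2 = ‖q‖ ^ 2 := by rw [LinearIsometryEquiv.norm_map]
    rw [hLq, norm_smul, mul_pow, Literature.Algebra.EuclideanLattices.norm_sq_fin_three q, q0, q1, q2] at h1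
    simp at h1
    linarith
  have hκ0 : κ ≠ 0 := by
    intro h
    rw [h] at hκ2
    norm_num at hκ2
  set ι : ℝ := κ⁻¹ with hι
  have hι2 : ι ^ 2 = 9 / 2 := by
    rw [hι, inv_pow, hκ2]
    norm_num
  have hLe2 : L (EuclideanSpace.single (2 : Fin 3) (1 : ℝ)) = ι • q := by
    have h := congrArg (fun w => L w) hLq
    simp only [LinearIsometryEquiv.apply_symm_apply, map_smul] at h
    rw [h, smul_smul, hι, inv_mul_cancel₀ hκ0, one_smul]
  have hc : c = (γ * ι) • q := by
    have h := congrArg (fun w => L w) hLc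
    simp only [LinearIsometryEquiv.apply_symm_apply, map_smul] at h
    rw [h, hLe2, smul_smul]
  -- ## the half-turn of the frame at the test point `P = (1/3, 0, 1/3)`
  set P : EuclideanSpace ℝ (Fin 3) := (1 / 3 : ℝ) • EuclideanSpace.single (0 : Fin 3) (1 : ℝ) +
    (1 / 3 : ℝ) • EuclideanSpace.single (2 : Fin 3) (1 : ℝ) with hPdef
  have P0 : P 0 = 1 / 3 := by simp [hPdef]
  have P1 : P 1 = 0 := by simp [hPdef]
  have P2 : P 2 = 1 / 3 := by simp [hPdef]
  set z₀ : EuclideanSpace ℝ (Fin 3) := L.symm (P - c) with hz₀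
  have hzP : L z₀ + c = P := by simp [hz₀]
  have hPq : ⟪P, q⟫_ℝ = 1 / 9 := by
    rw [Literature.Algebra.EuclideanLattices.inner_fin_three, P0, P1, P2, q0, q1, q2]
    norm_num
  have hqq : ⟪q, q⟫_ℝ = 2 / 9 := by
    rw [Literature.Algebra.EuclideanLattices.inner_fin_three, q0, q1, q2]
    norm_num
  have hz2 : z₀ 2 = ι * (1 / 9 - γ * ι * (2 / 9)) := by
    have h1 : z₀ 2 = ⟪z₀, EuclideanSpace.single (2 : Fin 3) (1 : ℝ)⟫_ℝ := by
      rw [EuclideanSpace.inner_single_right]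
      simp
    rw [h1, ← L.inner_map_map, hLe2, show L z₀ = P - c by rw [← hzP, add_sub_cancel_right], hc, inner_smul_right,
      inner_sub_left, inner_smul_left, hPq, hqq]
    simp
  have hrot : rotZ Real.pi z₀ = -z₀ + (2 * z₀ 2) • EuclideanSpace.single (2 : Fin 3) (1 : ℝ) := by
    ext i
    fin_cases i
    · simp [Real.cos_pi, Real.sin_pi]
    · simp [Real.cos_pi, Real.sin_pi]
    · simp
      ring
  have key : L (rotZ Real.pi z₀) + c = -P + q := by
    rw [hrot, map_add, map_neg, map_smul, hLe2, show L z₀ = P - c by rw [← hzP, add_sub_cancel_right], hc,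
      smul_smul, neg_sub]
    -- `(γι) q − P + (2 z₀2 ι) q + (γι) q`… collect the multiples of `q`
    have : ((γ * ι) • q - P) + ((2 * z₀ 2 * ι) • q) + (γ * ι) • q = -P + ((γ * ι) + 2 * z₀ 2 * ι + γ * ι) • q := by
      rw [add_smul, add_smul]
      abel
    rw [this]
    congr 1
    have h1 : γ * ι + 2 * z₀ 2 * ι + γ * ι = 1 := by
      rw [hz2]
      linear_combination (2 / 9 - 4 / 9 * γ * ι) * hι2
    rw [h1, one_smul]
  -- ## the reflected point has a different value of `|S|²`
  have hval : ‖sheetField (-P + q)‖ ^ 2 = ‖sheetField P‖ ^ 2 := by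
    rw [← key, hnorm Real.pi z₀, hzP]
  have uP : P 0 + P 2 = 2 / 3 := by rw [P0, P2]; norm_num
  have wP : P 1 - P 2 = -(1 / 3) := by rw [P1, P2]; norm_num
  have pP : P 1 + P 2 = 1 / 3 := by rw [P1, P2]; norm_num
  have uR : (-P + q) 0 + (-P + q) 2 = -(1 / 3) := by simp [P0, P2, q0, q2]
  have wR : (-P + q) 1 - (-P + q) 2 = 0 := by simp [P1, P2, q1, q2]
  have pR : (-P + q) 1 + (-P + q) 2 = -(2 / 3) := by simp [P1, P2, q1, q2]; norm_num
  rw [norm_sq_sheetField, norm_sq_sheetField, uP, wP, pP, uR, wR, pR, oddBump_third, oddBump_neg_third,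
    oddBump_zero, oddBump_neg] at hval
  nlinarith [bumpMax_pos, oddBump_two_thirds_pos, mul_pos bumpMax_pos oddBump_two_thirds_pos]

/-- **No slice of the three-sheet profile is axisymmetric in any rigid frame** (clause (11) of the residue stub
S2⁗). [folklore] -/
theorem sheetProfile_not_axisymmetric_anyFrame {s : ℝ} (hs : s < 0)
    (L : EuclideanSpace ℝ (Fin 3) ≃ₗᵢ[ℝ] EuclideanSpace ℝ (Fin 3)) (c : EuclideanSpace ℝ (Fin 3)) :
    ¬ IsAxisymmetric (fun y => L.symm (sheetProfile s (L y + c))) := by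
  intro hax
  have ha := (cellAmp_pos hs).ne'
  apply sheetField_not_axisymmetric_anyFrame L (cellAmp s • c + Real.log (-s) •
    (EuclideanSpace.single (1 : Fin 3) (1 : ℝ)))
  intro θ z
  have key : ∀ y : EuclideanSpace ℝ (Fin 3), L.symm (sheetProfile s (L y + c)) =
      cellAmp s • L.symm (sheetField (L (cellAmp s • y) + (cellAmp s • c + Real.log (-s) •
        (EuclideanSpace.single (1 : Fin 3) (1 : ℝ))))) := by
    intro y
    simp only [sheetProfile, driftShift, map_smul, smul_add, add_assoc]
  have h : L.symm (sheetProfile s (L (rotZ θ ((cellAmp s)⁻¹ • z)) + c)) =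
      rotZ θ (L.symm (sheetProfile s (L ((cellAmp s)⁻¹ • z) + c))) := hax θ ((cellAmp s)⁻¹ • z)
  have hz1 : cellAmp s • rotZ θ ((cellAmp s)⁻¹ • z) = rotZ θ z := by
    rw [← rotZ_smul, smul_smul, mul_inv_cancel₀ ha, one_smul]
  have hz2 : cellAmp s • ((cellAmp s)⁻¹ • z) = z := by rw [smul_smul, mul_inv_cancel₀ ha, one_smul]
  rw [key, key, hz1, hz2, rotZ_smul] at h
  exact smul_right_injective _ ha h

end Summit.NavierStokesRegularity.NavierStokesRegularity.Theorems.PoloidalWindowRigidity.Negative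

end
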